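import Literature.NumberTheory.EllipticCurves.GreenbergSelmerNewformDatum
import Literature.NumberTheory.EllipticCurves.CyclotomicPAdicLFunctionWeightK
import Literature.NumberTheory.EllipticCurves.IwasawaLambdaNorm
import Literature.NumberTheory.EllipticCurves.Rank1Residual.Predicates
import HarnessLib

/-!
# X. Wan, *The Iwasawa main conjecture for Hilbert modular forms*, Forum Math. Sigma 3 (2015) e18,
# Thm. 4 (= Thm. 103), RATIONAL PART — the cyclotomic main conjecture for an ordinary newform of
# even weight WITHOUT the hypothesis (ram)/(mult), in `Λ_{𝒪_L} ⊗ ℚ_p` (named fact, special case)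

HONEST FRAMING (cell `b2b-bsdres`, home `run/shared/lean/b2b/bsd-rank1-residual/`): the cell deletes
COMBINATION-SHAPED residual classes of the rank-`≤ 1` BSD formula from PUBLISHED theorems only and
types the rest; this is not "finishing BSD". This statement file (literature seat, gen 16) vendors
ONE published theorem as a named fact (D-0014) in the tree's vocabulary — the (V-alg)/(V-an)/(V-inv)
vocabulary of `GreenbergSelmerNewform(Datum)`, `CyclotomicPAdicLFunctionWeightK`, `IwasawaLambdaNorm`
(run/shared/lean/b2b/bsd-rank1-residual/b2b-bsdres-x11a/GL2-VOCAB-SPEC.md) — for the class-X11a chain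
(`Summits/BirchSwinnertonDyer/Rank1Residual/X11a/ChainSocket.lean`, shape `Chain.WanLambdaAt`).
Nothing is asserted; no `_holds`.

## Source, read by the vendoring seat (publisher PDF, doi:10.1017/fms.2015.16 =
## `paper:wan2015-iwasawa-main-conjecture-hilbert-modular-forms`; page numbers of that PDF)

* p. 3, Definition 2: "(irred) The residual Galois representation `ρ̄_f` of `f` is irreducible.
  (dist) For `V = ρ_f` and each prime `v | p`, the `𝒪_L^×`-valued characters giving the actions of
  `G_{F,v}` on `V_v^+` and `V/V_v^+` are distinct modulo the maximal ideal of `𝒪_L`."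
* pp. 4–5, **Theorem 4** (= Theorem 103, pp. 91–92, verbatim): "Suppose that `p ≥ 5`. Let
  `f ∈ S_κ(M, L)`, `κ ≥ 2`, `2 | κ`, `p ∤ M` and `L ⊂ ℚ̄_p` a finite extension of `ℚ_p`, be a
  `p`-ordinary cuspidal eigenform with trivial central character. Suppose that • (irred) and (dist)
  hold for `ρ_f`; then, for any set of primes `Σ`, `char^Σ_{ℚ_∞,L}(f) = (L^Σ_f)` in
  `Λ_{ℚ,𝒪_L} ⊗_{ℤ_p} ℚ_p`. If, furthermore, • there is an `𝒪_L`-basis of `T_f` with respect to which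
  the image of `ρ_f` contains `SL₂(ℤ_p)`, and • there exists a real quadratic extension `F/ℚ` such
  that – `p` is unramified in `F`, – any prime `ℓ` dividing `M` such that `ℓ ≡ −1 (mod p)` is inert
  in `F`, and any other prime divisors of `M` is split in `F`, and – the canonical period of `f` over
  `F` is a `p`-adic unit times the square of its canonical period over `ℚ`, then the equality holds in
  `Λ_{ℚ,𝒪_L}`." p. 4: "Our next result (Theorem 103) states that the main theorem of [44, Theorem
  3.29] is true without the third assumption in [44]" ([44] = Skinner–Urban 2014; the third assumption
  = the auxiliary prime `ℓ ‖ M` with `ρ̄_f|_{G_{ℚ_ℓ}}` ramified, p. 91: "without one of the technical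
  local assumptions (namely the existence of an `ℓ ‖ M` with `ρ̄|_{G_{ℚ_ℓ}}` ramified)").
* p. 92 (proof of Thm. 103): "We need to know the Gorensteinness for the base change to `F`. Since
  `p ≥ 5`, this follows from [6]. In order to apply Theorem 86 we have to check the assumptions in
  Theorem 8 [Fujiwara]. The first and second assumptions are trivially true. … The assumption on the
  canonical periods for base change is used to ensure that the `p`-adic `L`-function of the base
  change splits into `p`-adic `L`-functions over `ℚ`." — the period assumption qualifies the INTEGRAL
  refinement only (it is not among the hypotheses of the rational equality).
* The objects (pp. 15–18, §2.4–2.5, "following [44, 3.1] with some modifications"): `T_f` "a Galois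
  stable `𝒪_L` lattice … unique after scaling" (p. 15); `Sel^Σ_F(T, (T_v)_{v|p}) = ker(H¹(F, T ⊗ A^*)
  → ∏_{v ∉ Σ, v ∤ p} H¹(I_v, T ⊗ A^*) × ∏_{v | p} H¹(I_v, T/T_v ⊗ A^*))` (p. 15), its Pontryagin dual
  `X^Σ`, `char_A(X) := {x : ord_Q(x) ≥ length_Q(X) ∀ Q height one}`, "if `X` is not torsion then we
  define `char_A(X) = 0`" (p. 16). For `F = ℚ` these are Skinner–Urban's (Invent. Math. 195 (2014))
  `Sel_{ℚ_∞,L}(f) = Sel(T_f(det ρ_f⁻¹), T_f^+(det ρ_f⁻¹))` (§3.3, p. 32: the twist with UNRAMIFIED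
  QUOTIENT and arithmetic-Frobenius trace `a_ℓ`, i.e. Emerton–Pollack–Weston's `ρ_f`, `A_f`, `A_f'` of
  Invent. Math. 163 (2006) §3.1) and `𝓛_f ∈ Λ_{ℚ,𝒪_L}`, "the Manin–Vishik `p`-adic `L`-function"
  (§3.4.4, p. 38: `φ(γ) = ζ(1+p)^m`, `0 ≤ m ≤ k − 2` ↦ `e_p(φ)(p^{t}…)^{m+1} m! L(f, ω^{−m}χ_φ⁻¹, m+1)
  / ((−2πi)^m G(…) Ω_f^±)` — at `m = 0` the values `L(f, χ⁻¹, 1)/Ω_f^±` for `χ` of `p`-power conductor: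
  the Mazur–Tate–Teitelbaum function of `IsCycPAdicLFunctionWeightK`, up to the (canonical vs
  arbitrary) period, a non-zero constant of `L`); SU14 §3.5.4–3.5.6 (p. 41): "By Theorem 3.3.7 (due to
  Kato) the dual Selmer group `X_{ℚ_∞,L}(f)` is torsion", Conj. 3.5.5 "`Ch_{ℚ_∞,L}(f) = (𝓛_f)` in
  `Λ_{ℚ,𝒪_L} ⊗ ℚ_p`, with the equality holding in `Λ` if (irred) holds".
* STATUS / FRESHNESS (read 2026-08-20): Burungale–Castella–Skinner, *Base change and Iwasawa Main
  Conjectures for GL₂* (arXiv:2405.00270 = IMRN 2025), §3.1: "The results of [Wan15] are conditional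
  on the following hypothesis. Hypothesis 3.1.1. (H1) `ρ̄_g|_{G_{F(ζ_p)}}` is absolutely irreducible,
  and for `p = 5` the following case is excluded: the projective image `Ḡ` of `ρ̄_g|_{G_F}` is
  isomorphic to `PGL₂(𝔽_p)` and the mod `p` cyclotomic character factors through `G_F → Ḡ^{ab} ≃ ℤ/2ℤ`
  … (H2) There is a minimal modular lifting of `ρ̄_g|_{G_F}` (cf. [Fuj06, Def. 6.11]). (H3) For any
  finite place `v` of `F`, if `ρ̄_g|_{G_{F_v}}` is absolutely irreducible and `ρ̄_g|_{I_v}` is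
  absolutely reducible, then `q_v ≢ −1 (mod p)`"; Rem. 3.1.2 (iii): "The case excluded by (H1) does
  not occur for `g` corresponding to elliptic curves"; p. 10: "(H2) follows as in [Wan, Thm. 103]
  (indeed, by our choice of `F`, the base change to `F` of a minimal modular lifting of `ρ̄_g` gives a
  minimal modular lifting of `ρ̄_{g_F}`), and (H3) also follows by condition (iii) on `F`";
  Rem. 1.1.3 (ii): "The only prior result towards Conjecture 1.1.1 [the INTEGRAL cyclotomic main
  conjecture for `E`] without assuming the hypothesis (mult) is due to Wan [Wan15] … However, it is
  conditional on a `p`-integral comparison of certain automorphic periods, which still remains open";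
  Rem. 3.2.2: "Wan uses the above divisibility in conjunction with base change to remove the condition
  (mult) from the result of [SU14] up to tensoring with `ℚ_p` (cf. [Wan15, Thm. 4])". So: the INTEGRAL
  refinement of Thm. 4 carries an unverified period hypothesis; the RATIONAL part (typed here) is used
  as printed by BCS 2025 themselves, under Fujiwara's (H1)–(H3), which the printed hypothesis list
  (irred)+(dist) does not literally contain (flag `Wan15-Thm103-Fujiwara` of the cell's audit
  HOME/b2b-bsdres-lit/g14/X11A-AUDIT.md (b)) — whence the SPECIAL CASE below.

## The typed special case and its reading (for the referee's C-audit)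

SPECIAL CASE: `f` = the ordinary `p`-stabilisation of a newform `g ∈ S_k(Γ₀(M))` (`IsNewform0`,
trivial character), `k ≥ 2` even, `5 ≤ p ∤ M`, `ι : K_g → ℚ̄_p` with `|ι(a_p(g))|_p = 1`
(`p`-ordinary), `L = ℚ_p(ι K_g)` (`padicCoeffField ι`), and `ρ̄_f ≅ E[p]` for an elliptic curve
`E/ℚ` (globally minimal `W`) with `ρ̄_{E,p}` SURJECTIVE — witnessed by the congruences
`|ι(a_ℓ(g)) − a_ℓ(E)|_p < 1` at all primes `ℓ ∤ M·N_E·p` (Brauer–Nesbitt–Chebotarev: `ρ̄_f^{ss} ≅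
E[p]^{ss} = E[p]`). Then (irred) holds; (H1): `ρ̄(G_{ℚ(ζ_p)}) = SL₂(𝔽_p)` (kernel of `det` on
`GL₂(𝔽_p)`), and `SL₂(𝔽_p)` being perfect for `p ≥ 5` the image of `G_{F(ζ_p)}` (index `≤ 2`) is
still `SL₂(𝔽_p)`, absolutely irreducible; the `p = 5` exclusion does not occur (BCS Rem. 3.1.2 (iii));
(H2), (H3): as printed by Wan p. 92 / BCS p. 10 (choice of `F`); (dist) is AUTOMATIC: for trivial
character and `p ∤ M` the two characters are `ε^{k−1}φ⁻¹` and `φ` (`φ` unramified, EPW (eq:ordes)),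
which on inertia reduce to `ω^{k−1}` and `1`, distinct because `k − 1` is odd and `ω` has even order
`p − 1` (Wan p. 6 makes the same remark in weight `2`: "(dist) is ensured by other assumptions because
the two characters giving the diagonal actions of the inertial group at `p` are the trivial character
and the cyclotomic character").
READING of "`char_{ℚ_∞,L}(f) = (L_f)` in `Λ_{ℚ,𝒪_L} ⊗ ℚ_p`" (Σ = ∅) on `λ`-INVARIANTS, in the LIGHT
currency of GL2-VOCAB-SPEC §5 (EPW Thm. 3.1.1, Invent. Math. 163 (2006) p. 17: "`Sel(ℚ_∞, A_f)` is
co-finitely generated, `Λ_𝒪`-cotorsion [Kato] … `μ^alg(f)` vanishes if and only if `Sel(ℚ_∞, A_f)[π]`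
is finite. If this is the case, then … `λ^alg(f) = dim_k Sel(ℚ_∞, A_f)[π]`"): the equality of ideals
in `Λ ⊗ ℚ_p = 𝒪⟦T⟧[1/π]` says `L_f = π^a · w · (char. series)` with `a ∈ ℤ`, `w ∈ Λ^×`, and
`char ≠ 0` (torsion), so `L_f ≠ 0` has a coefficient of maximal norm (`HasMaxCoeff`; discretely valued
bounded coefficients) and `normLam L_f` = Weierstrass degree of the characteristic series = `λ^alg(f)`
(`normLam` is invariant under non-zero scalars — any period — and under `Λ^×`, EPW Lemma 4.4.2 /
Def. 4.4.6); IF moreover `Sel(ℚ_∞, A_f)[π]` is finite (`μ^alg(f) = 0`), THEN `λ^alg(f) =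
dim_k Sel(ℚ_∞, A_f)[π]` (Thm. 3.1.1), i.e. `torsionDim = normLam L`. Over `ℚ_∞` the local condition
"unramified at `v ∤ p`" of Wan/SU equals Greenberg's/EPW's "trivial at `v ∤ p`" (`G_v/I_v` is
pro-prime-to-`p` on `p`-primary modules; Greenberg, LNM 1716 §2), so `Sel^∅_{ℚ_∞}` IS
`OrdinaryNewformDatum.selmer` = EPW's `Sel(ℚ_∞, A_f)`; the coefficient field is pinned to
`ℚ_p(ι K_g) = ℚ_p(aₙ(f))` (EPW's `K`; `λ^alg`, `μ^alg = 0` are in any case insensitive to a finite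
extension of scalars, module docstring of `GreenbergSelmerNewformDatum`). ASSEMBLED READING, for the
D-audit: Wan Thm. 4 (rational) ∘ EPW Thm. 3.1.1 (∘ Kato's cotorsion, quoted in both).
`-- TODO(general form): Wan's statement for every f with (irred) [proof: + Fujiwara (H1)–(H3)],
-- Σ-imprimitive versions, the integral refinement, Hilbert modular forms (Thms. 3, 7, 101–102);
-- the FULL currency (∃ a w, L = π^a·w·charSeries for a DualData) once Λ_𝒪-structure theory is in the tree.`

## References

* X. Wan, Forum Math. Sigma 3 (2015) e18, Def. 2 (p. 3), Thm. 4 (pp. 4–5) = Thm. 103 (pp. 91–92),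
  §2.3–2.5 (pp. 14–18), Thm. 82 (pp. 66–67). [Wan2015HilbertIMC]
* C. Skinner, E. Urban, Invent. Math. 195 (2014), §3.3 (pp. 32–33), §3.4.4 (p. 38), §3.5.4–3.5.6,
  Thm. 3.6.1 (p. 41). [SkinnerUrban2014]
* M. Emerton, R. Pollack, T. Weston, Invent. Math. 163 (2006), §3.1 + Thm. 3.1.1 (p. 17),
  Lemma 4.4.2, Def. 4.4.6 (pp. 23–24). [EmertonPollackWeston2006]
* A. Burungale, F. Castella, C. Skinner, arXiv:2405.00270 (IMRN 2025), Rem. 1.1.3, Hyp. 3.1.1,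
  Rem. 3.1.2, Thm. 3.2.1, Rem. 3.2.2, p. 10. [BurungaleCastellaSkinner2025]
* K. Kato, Astérisque 295 (2004), Thm. 17.4. [Kato2004Asterisque]
* R. Greenberg, LNM 1716 (1999), §2. [GreenbergLNM1716]
* HOME/b2b-bsdres-lit/g14/X11A-AUDIT.md (b), (d); HOME/b2b-bsdres-x11a/GL2-VOCAB-SPEC.md §2, §5.
-/

noncomputable section

open scoped Classical MatrixGroups ModularForm

open CongruenceSubgroup UpperHalfPlane WeierstrassCurve
  Literature.NumberTheory.EllipticCurves.ModularForms
  Literature.NumberTheory.EllipticCurves.GreenbergSelmer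

namespace Literature.NumberTheory.EllipticCurves.Wan2015

/-- **X. Wan, Forum Math. Sigma 3 (2015) e18, Thm. 4 (pp. 4–5) = Thm. 103 (pp. 91–92), RATIONAL
PART, special case "`ρ̄_f ≅ E[p]` with `ρ̄_{E,p}` surjective", read on `λ`-invariants.** VERBATIM:
"Suppose that `p ≥ 5`. Let `f ∈ S_κ(M, L)`, `κ ≥ 2`, `2 | κ`, `p ∤ M` and `L ⊂ ℚ̄_p` a finite
extension of `ℚ_p`, be a `p`-ordinary cuspidal eigenform with trivial central character. Suppose
that (irred) and (dist) hold for `ρ_f`; then, for any set of primes `Σ`, `char^Σ_{ℚ_∞,L}(f) = (L^Σ_f)`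
in `Λ_{ℚ,𝒪_L} ⊗_{ℤ_p} ℚ_p`" [integral refinement under further hypotheses not typed].
TYPED (module docstring for every identification): `W/ℚ` globally minimal elliptic, `5 ≤ p`,
`ρ̄_{W,p}` SURJECTIVE; `g ∈ S_k(Γ₀(M))` a newform, `2 ≤ k` even, `p ∤ M`, `ι : K_g → ℚ̄_p` with
`|ι(a_p(g))|_p = 1`, congruent to `W`: `|ι(a_ℓ(g)) − a_ℓ(W)|_p < 1` for all primes `ℓ ∤ M·N_W·p`
(⇒ `ρ̄_f ≅ W[p]`: (irred), Fujiwara (H1)–(H3); (dist) automatic, `k` even); for every integral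
ordinary datum `Δ = (ρ, A', π)` of `(g, ι)` over `𝒪 = 𝒪_{ℚ_p(ιK_g)}` (`OrdinaryNewformDatum`), the
cyclotomic `ℤ_p`-extension `κ`, the unit root `υ`, any period–symbol datum `D` and THE cyclotomic
`p`-adic `L`-function `L` of `(g, ι, υ, D)` (`IsCycPAdicLFunctionWeightK`): IF `Sel(ℚ_∞, A_f)[π]` is
finite THEN `L` attains its maximal coefficient norm and `dim_k Sel(ℚ_∞, A_f)[π] = normLam L`
("`λ^alg(f) = λ^an(f)`"; reading through EPW Thm. 3.1.1 and Kato's cotorsion, both quoted — module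
docstring). Named fact (`def … : Prop`); nothing asserted (inputs: Eisenstein congruences on
`U(2,2)`, Hida theory over a real quadratic field, Kato's Euler system — none in Mathlib or the tree).
Flags for the referee: `Wan15-Thm103-Fujiwara` (BCS 2025 Hyp. 3.1.1), `Wan15-BCS25-Rem113ii`
(integral part conditional; rational part used as printed, BCS 2025 Rem. 3.2.2).
**RETIRED-MISQUANTIFIED (boundedness) (cell `b2b-bsdres`, registry A79; referee ruling R121.2 (iii),
2026-08-20; deprecate-and-add):** the conclusion is quantified over EVERY interpolant `L` of
`IsCycPAdicLFunctionWeightK`, a predicate that does not determine `L` — with `L` also the unbounded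
`L + log(1+T)` satisfies it, and for that series `HasMaxCoeff` fails, so the `Prop` is not the printed
statement (which concerns THE bounded `𝓛_f ∈ Λ_{ℚ,𝒪_L} ⊗ ℚ_p`) and is false as typed whenever the
Selmer hypothesis holds (same defect as `Wan2015.thm4_rational_weightK_member`, registry A87,
RETIRED-MISSTATED). No module imports this declaration; in use it is superseded by
`Wan2015.thm4_rational_weightK_member_of_bdd` (`Wan2015RationalMainConjecture.lean`, registry A145;
bounded-coefficient binder, uniqueness by the tree theorem `IsCycPAdicLFunctionWeightK.eq_of_bounded`).
Kept verbatim (statement unchanged); do not use; to be removed.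
-- TODO(general form): see the module docstring.
[cite: Wan2015HilbertIMC, Thm. 4 (pp. 4–5) = Thm. 103 (pp. 91–92); Def. 2 (p. 3); §2.4–2.5 (pp. 15–18)]
[cite: SkinnerUrban2014, §3.3 (pp. 32–33), §3.4.4 (p. 38), §3.5.4–3.5.6 (p. 41)]
[cite: EmertonPollackWeston2006, Thm. 3.1.1 and §3.1 (p. 17); Lemma 4.4.2, Def. 4.4.6 (pp. 23–24)]
[cite: BurungaleCastellaSkinner2025, Hyp. 3.1.1, Rem. 3.1.2, Rem. 1.1.3 (ii), Rem. 3.2.2, p. 10] -/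
def thm4_rational_torsionDim_eq_normLam : Prop :=
  ∀ (W : WeierstrassCurve ℚ) [W.IsElliptic] [W.IsGloballyMinimal] (p : ℕ) [Fact p.Prime],
    5 ≤ p → W.HasSurjectiveModNGaloisRep p →
  ∀ {M : ℕ} [NeZero M] {k : ℤ} (g : CuspForm (Gamma0 M) k) (ι : coeffField g →+* PadicAlgCl p),
    IsNewform0 g → 2 ≤ k → Even k → ¬ p ∣ M →
    ‖ι ⟨(qExpansion 1 ⇑g).coeff p, coeff_mem_coeffField g p⟩‖ = 1 →
    (∀ ℓ : ℕ, ℓ.Prime → ¬ ℓ ∣ M → ¬ ℓ ∣ W.conductorNorm ℤ → ℓ ≠ p →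
      ‖ι ⟨(qExpansion 1 ⇑g).coeff ℓ, coeff_mem_coeffField g ℓ⟩
          - ((W.frobeniusTrace ℓ : ℤ) : PadicAlgCl p)‖ < 1) →
  ∀ (Δ : OrdinaryNewformDatum g p ι) (κ : ZpExtension ℚ p), κ.IsCyclotomic →
  ∀ (υ : PadicAlgCl p) (D : PeriodSymbolDatum g) (L : PowerSeries (PadicAlgCl p)),
    υ ^ 2 - ι ⟨(qExpansion 1 ⇑g).coeff p, coeff_mem_coeffField g p⟩ * υ
        + (p : PadicAlgCl p) ^ (k - 1).toNat = 0 →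
    ‖υ‖ = 1 → IsCycPAdicLFunctionWeightK g D p ι υ L →
    Finite (Δ.selmerTorsion κ) →
      HasMaxCoeff L ∧ Δ.torsionDim κ = normLam L

end Literature.NumberTheory.EllipticCurves.Wan2015

end
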